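import Literature.Computability.AlgebraicComplexity.MS21DiagonalTensorOrbitsHittingProofs
import HarnessLib

/-!
# Medini–Shpilka 2021, Thm 45 in every characteristic — I: the swapped dual set and the
# decoupling (structure) lemma

Theorem-only support file (cell `val-lit`, seat x6 g3) towards the ALL-FIELDS form of the typed fact
`MS2021_thm_45` [MediniShpilka2021, Thm 45 (CCC p.19:14) = arXiv ‹PITsumSDMinv› p0009:L9-L12; printed
proof §6.2, p0036:L1-L52].  The tree's `MS2021.thm_45_of_cast_ne_zero` (this seat,
`MS21DiagonalTensorOrbitsHittingProofs.lean`) proves it when `2, …, min(d₁,d₂) ≠ 0` in `K`, following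
the print; the printed sub-case "some `a_{i,j} ≥ 2`" (p0036:L38-L42) does not survive small
characteristic (the needed coefficient is `a_{i,j}(a_{i,j}-1)·c`).  The repair (seat note
`HOME/np/x6g3-MS21-Thm45-allchar-REPAIR.md`) replaces, for `d ≥ 3`, the printed Case B by the dual set
of the SECOND family acting on the first:

* `∂_{v_c} (T' ∘ M) = (∂_c T') ∘ M` for the dual vectors `v_c` (`M v_c = e_c`) of the forms
  `m_c = ∑_w M_{c,w} y_w` (`dirDeriv_aeval_linear`, `dualDeriv_aeval_linear`), so
  `∂_{v_c}∂_{v_{c'}}` kills `f₂ = T'(m)` whenever `c, c'` lie in different blocks or `c = c'`;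
* on `T = ∑_a ∏_j y_{a,j}` itself, for `d ≥ 3`, the coefficient of `y^{row a ∖ {j₁,j₂}}` in
  `∂_v ∂_{v'} T` is `v_{a,j₁} v'_{a,j₂} + v_{a,j₂} v'_{a,j₁}` (`coeff_dirDeriv_dirDeriv_sum_prod_X`) —
  no exponent enters, only products of coordinates of `v, v'` (for `v = v'`: `2 v_{a,j₁} v_{a,j₂}`);
  a nonvanishing such coefficient (a WITNESS) makes `∂²f/∂u∂w = ∂²f₁/∂u∂w ≠ 0`, and Lemma 6.2
  (`k = 2`) finishes (`bind₁_sub_ne_zero_of_witness`, 6 blocks, every field);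
* THE DECOUPLING LEMMA (`exists_perm_span_eq_of_forall_witness_eq_zero`, pure linear algebra, every
  field, `d ≥ 2`): if NO witness exists then the coefficient matrix `N` (`ℓ_{1,w} = ∑_c N_{w,c} ℓ_{2,c}`)
  is block-permutation: there is a bijection `β` with `span{ℓ_{1,a,·}} = span{ℓ_{2,β(a),·}}` for
  every `a`, i.e. `f = ∑_a (∏_j ℓ_{1,a,j} - ∏_j ℓ_{2,β(a),j})` decouples row by row (the endgame —
  restriction to `ker ℓ_{2,β(a₀),j₀}`, one derivative, a product of linear forms — is part II).

No definitions, no facts (D-0026). HONEST FRAMING: infrastructure for a 2021 PIT theorem;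
`VP ≠ VNP` is NOT proved.

## References
* [MediniShpilka2021] D. Medini, A. Shpilka, CCC 2021 (LIPIcs 200:19) Thm 45; arXiv:2102.05632 §6.2
  (p0035:L10-L12 "`∂²T/∂x_{i,j}∂x_{i',j'} = 0`", p0036:L1-L52), Lemma 3.8 (p0017:L61-L68).
* [Humphreys1990] chain rule, via `Literature.Algebra.Polynomial.JacobianCriterion.pderiv_aeval`.
-/

noncomputable section

open MvPolynomial Matrix

namespace Literature.Computability.AlgebraicComplexity

namespace MS2021

/-! ### Second derivatives of `∑_a ∏_j x_{(a,j)}` along two arbitrary directions (`d ≥ 3`) -/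

section SecondDerivative

variable {K : Type*} [Field K] {s d : ℕ}

/-- `e_w + e_{w'} = e_{v₁} + e_{v₂}` forces `{w, w'} = {v₁, v₂}`. [folklore] -/
private theorem single_add_single_eq {σ : Type*} {w w' v₁ v₂ : σ}
    (h : (Finsupp.single w 1 + Finsupp.single w' 1 : σ →₀ ℕ) =
      Finsupp.single v₁ 1 + Finsupp.single v₂ 1) :
    (w = v₁ ∧ w' = v₂) ∨ (w = v₂ ∧ w' = v₁) := by
  rcases (Finsupp.single_add_single_eq_single_add_single one_ne_zero one_ne_zero).1 h with
    h' | ⟨-, h'⟩ | ⟨h', -⟩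
  · exact Or.inl h'
  · exact Or.inr h'
  · exact absurd h' (by norm_num)

/-- For `d ≥ 3`: if `(row a ∖ {j₁, j₂}) + e_w + e_{w'}` is a row exponent then `{w, w'} =
{(a,j₁), (a,j₂)}` (the remaining `d - 2 ≥ 1` variables of row `a` pin the row down). [folklore] -/
private theorem eq_of_rowExp_sub_add (hd : 3 ≤ d) {a : Fin s} {j₁ j₂ : Fin d} (hj : j₁ ≠ j₂)
    {w w' : Fin s × Fin d} {a' : Fin s}
    (h : (∑ j : Fin d, Finsupp.single (a, j) 1 : Fin s × Fin d →₀ ℕ) - Finsupp.single (a, j₁) 1 -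
        Finsupp.single (a, j₂) 1 + Finsupp.single w 1 + Finsupp.single w' 1 =
      ∑ j : Fin d, Finsupp.single (a', j) 1) :
    (w = (a, j₁) ∧ w' = (a, j₂)) ∨ (w = (a, j₂) ∧ w' = (a, j₁)) := by
  classical
  -- a third column `j₃` of row `a`
  obtain ⟨j₃, hj₃₁, hj₃₂⟩ : ∃ j₃ : Fin d, j₃ ≠ j₁ ∧ j₃ ≠ j₂ := by
    by_contra hno
    push Not at hno
    have hsub : (Finset.univ : Finset (Fin d)) ⊆ {j₁, j₂} := by
      intro j _
      rw [Finset.mem_insert, Finset.mem_singleton]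
      by_cases h1 : j = j₁
      · exact Or.inl h1
      · exact Or.inr (hno j h1)
    have := Finset.card_le_card hsub
    rw [Finset.card_univ, Fintype.card_fin] at this
    have h2 := Finset.card_insert_le j₁ ({j₂} : Finset (Fin d))
    rw [Finset.card_singleton] at h2
    omega
  have hv₁₂ : ((a, j₁) : Fin s × Fin d) ≠ (a, j₂) := fun h' => hj (Prod.mk.inj h').2
  have ha : a' = a := by
    by_contra hne
    have e := Finsupp.ext_iff.1 h (a, j₃)
    rw [Finsupp.add_apply, Finsupp.add_apply, Finsupp.tsub_apply, Finsupp.tsub_apply, rowExp_apply,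
      rowExp_apply, if_pos rfl, if_neg (fun h' => hne h'.symm), Finsupp.single_apply,
      Finsupp.single_apply, if_neg (fun h' => hj₃₁ (Prod.mk.inj h').2.symm),
      if_neg (fun h' => hj₃₂ (Prod.mk.inj h').2.symm), Finsupp.single_apply,
      Finsupp.single_apply] at e
    split_ifs at e
  subst ha
  have hle₁ : Finsupp.single (a', j₁) 1 ≤ (∑ j : Fin d, Finsupp.single (a', j) 1 : Fin s × Fin d →₀ ℕ) :=
    Finsupp.single_le_iff.2 (by rw [rowExp_apply, if_pos rfl])
  have hle₂ : Finsupp.single (a', j₂) 1 ≤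
      (∑ j : Fin d, Finsupp.single (a', j) 1 : Fin s × Fin d →₀ ℕ) - Finsupp.single (a', j₁) 1 := by
    refine Finsupp.single_le_iff.2 ?_
    rw [Finsupp.tsub_apply, rowExp_apply, if_pos rfl, Finsupp.single_apply, if_neg hv₁₂]
    omega
  have key : (Finsupp.single w 1 + Finsupp.single w' 1 : Fin s × Fin d →₀ ℕ) =
      Finsupp.single (a', j₁) 1 + Finsupp.single (a', j₂) 1 := by
    have e : ((∑ j : Fin d, Finsupp.single (a', j) 1 : Fin s × Fin d →₀ ℕ) -
        Finsupp.single (a', j₁) 1 - Finsupp.single (a', j₂) 1) +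
        (Finsupp.single w 1 + Finsupp.single w' 1) =
        ((∑ j : Fin d, Finsupp.single (a', j) 1 : Fin s × Fin d →₀ ℕ) -
        Finsupp.single (a', j₁) 1 - Finsupp.single (a', j₂) 1) +
        (Finsupp.single (a', j₁) 1 + Finsupp.single (a', j₂) 1) := by
      rw [← add_assoc, h, add_comm (Finsupp.single (a', j₁) 1), ← add_assoc,
        tsub_add_cancel_of_le hle₂, tsub_add_cancel_of_le hle₁]
    exact add_left_cancel e
  exact single_add_single_eq key

/-- **The coefficients of a second directional derivative of `T' = ∑_a ∏_j x_{(a,j)}`** (`d ≥ 3`):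
the coefficient of `x^{row a ∖ {j₁, j₂}}` (`j₁ ≠ j₂`) in `∂_v ∂_{v'} T'` is
`v_{(a,j₁)} v'_{(a,j₂)} + v_{(a,j₂)} v'_{(a,j₁)}` — "for any two variables in distinct product gates
`∂²T/∂x_{i,j}∂x_{i',j'} = 0`", and within a gate only the pair `{j₁, j₂}` contributes.
[cite: MediniShpilka2021, §6.2 (arXiv p0035:L10-L12) and proof of Thm 45 (p0036:L38-L50)] -/
theorem coeff_dirDeriv_dirDeriv_sum_prod_X (hd : 3 ≤ d) (v v' : Fin s × Fin d → K) (a : Fin s)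
    {j₁ j₂ : Fin d} (hj : j₁ ≠ j₂) :
    coeff ((∑ j : Fin d, Finsupp.single (a, j) 1) - Finsupp.single (a, j₁) 1 -
        Finsupp.single (a, j₂) 1)
      (∑ w, C (v w) * pderiv w (∑ w', C (v' w') * pderiv w'
        (∑ a : Fin s, ∏ j : Fin d, X (a, j) : MvPolynomial (Fin s × Fin d) K))) =
      v (a, j₁) * v' (a, j₂) + v (a, j₂) * v' (a, j₁) := by
  classical
  have hd0 : 0 < d := by omega
  have hv₁₂ : ((a, j₁) : Fin s × Fin d) ≠ (a, j₂) := fun h' => hj (Prod.mk.inj h').2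
  have hle₁ : Finsupp.single (a, j₁) 1 ≤ (∑ j : Fin d, Finsupp.single (a, j) 1 : Fin s × Fin d →₀ ℕ) :=
    Finsupp.single_le_iff.2 (by rw [rowExp_apply, if_pos rfl])
  have hle₂ : Finsupp.single (a, j₂) 1 ≤
      (∑ j : Fin d, Finsupp.single (a, j) 1 : Fin s × Fin d →₀ ℕ) - Finsupp.single (a, j₁) 1 := by
    refine Finsupp.single_le_iff.2 ?_
    rw [Finsupp.tsub_apply, rowExp_apply, if_pos rfl, Finsupp.single_apply, if_neg hv₁₂]
    omega
  -- values of `μ := row a ∖ {j₁, j₂}` at the two removed positions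
  have hμ₁ : (((∑ j : Fin d, Finsupp.single (a, j) 1) - Finsupp.single (a, j₁) 1 -
      Finsupp.single (a, j₂) 1 : Fin s × Fin d →₀ ℕ)) (a, j₁) = 0 := by
    rw [Finsupp.tsub_apply, Finsupp.tsub_apply, rowExp_apply, if_pos rfl, Finsupp.single_apply,
      if_pos rfl, Finsupp.single_apply, if_neg (Ne.symm hv₁₂)]
    omega
  have hμ₂ : (((∑ j : Fin d, Finsupp.single (a, j) 1) - Finsupp.single (a, j₁) 1 -
      Finsupp.single (a, j₂) 1 : Fin s × Fin d →₀ ℕ)) (a, j₂) = 0 := by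
    rw [Finsupp.tsub_apply, Finsupp.tsub_apply, rowExp_apply, if_pos rfl, Finsupp.single_apply,
      if_neg hv₁₂, Finsupp.single_apply, if_pos rfl]
    omega
  -- the coefficient of one term `∂_w ∂_{w'} T'`
  have hterm : ∀ w w' : Fin s × Fin d,
      coeff ((∑ j : Fin d, Finsupp.single (a, j) 1) - Finsupp.single (a, j₁) 1 -
          Finsupp.single (a, j₂) 1)
        (pderiv w (pderiv w' (∑ a : Fin s, ∏ j : Fin d, X (a, j) : MvPolynomial (Fin s × Fin d) K))) =
        (if w = (a, j₁) ∧ w' = (a, j₂) then 1 else 0) +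
          (if w = (a, j₂) ∧ w' = (a, j₁) then 1 else 0) := by
    intro w w'
    rw [coeff_pderiv, coeff_pderiv, coeff_sum_prod_X hd0]
    by_cases h12 : w = (a, j₁) ∧ w' = (a, j₂)
    · obtain ⟨rfl, rfl⟩ := h12
      have hex : ∃ a' : Fin s, ((∑ j : Fin d, Finsupp.single (a, j) 1) - Finsupp.single (a, j₁) 1 -
          Finsupp.single (a, j₂) 1 : Fin s × Fin d →₀ ℕ) + Finsupp.single (a, j₁) 1 +
          Finsupp.single (a, j₂) 1 = ∑ j : Fin d, Finsupp.single (a', j) 1 :=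
        ⟨a, by rw [add_assoc, add_comm (Finsupp.single (a, j₁) 1), ← add_assoc,
          tsub_add_cancel_of_le hle₂, tsub_add_cancel_of_le hle₁]⟩
      have hc₁ : ((a, j₁) : Fin s × Fin d) = (a, j₁) ∧ ((a, j₂) : Fin s × Fin d) = (a, j₂) :=
        ⟨rfl, rfl⟩
      have hc₂ : ¬(((a, j₁) : Fin s × Fin d) = (a, j₂) ∧ ((a, j₂) : Fin s × Fin d) = (a, j₁)) :=
        fun h' => hv₁₂ h'.1
      rw [if_pos hex, if_pos hc₁, if_neg hc₂, hμ₁, Finsupp.add_apply, hμ₂, Finsupp.single_apply,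
        if_neg hv₁₂]
      push_cast
      ring
    by_cases h21 : w = (a, j₂) ∧ w' = (a, j₁)
    · obtain ⟨rfl, rfl⟩ := h21
      have hex : ∃ a' : Fin s, ((∑ j : Fin d, Finsupp.single (a, j) 1) - Finsupp.single (a, j₁) 1 -
          Finsupp.single (a, j₂) 1 : Fin s × Fin d →₀ ℕ) + Finsupp.single (a, j₂) 1 +
          Finsupp.single (a, j₁) 1 = ∑ j : Fin d, Finsupp.single (a', j) 1 :=
        ⟨a, by rw [tsub_add_cancel_of_le hle₂, tsub_add_cancel_of_le hle₁]⟩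
      have hc₁ : ((a, j₂) : Fin s × Fin d) = (a, j₂) ∧ ((a, j₁) : Fin s × Fin d) = (a, j₁) :=
        ⟨rfl, rfl⟩
      rw [if_pos hex, if_neg h12, if_pos hc₁, hμ₂, Finsupp.add_apply, hμ₁, Finsupp.single_apply,
        if_neg (Ne.symm hv₁₂)]
      push_cast
      ring
    · have hex : ¬∃ a' : Fin s, ((∑ j : Fin d, Finsupp.single (a, j) 1) - Finsupp.single (a, j₁) 1 -
          Finsupp.single (a, j₂) 1 : Fin s × Fin d →₀ ℕ) + Finsupp.single w 1 +
          Finsupp.single w' 1 = ∑ j : Fin d, Finsupp.single (a', j) 1 := by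
        rintro ⟨a', ha'⟩
        rcases eq_of_rowExp_sub_add hd hj ha' with h' | h'
        · exact h12 h'
        · exact h21 h'
      rw [if_neg h12, if_neg h21, if_neg hex]
      simp
  -- expand the double sum
  have hexp : (∑ w, C (v w) * pderiv w (∑ w', C (v' w') * pderiv w'
      (∑ a : Fin s, ∏ j : Fin d, X (a, j) : MvPolynomial (Fin s × Fin d) K))) =
      ∑ w, ∑ w', C (v w * v' w') *
        pderiv w (pderiv w' (∑ a : Fin s, ∏ j : Fin d, X (a, j) : MvPolynomial (Fin s × Fin d) K)) := by
    refine Finset.sum_congr rfl fun w _ => ?_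
    rw [map_sum, Finset.mul_sum]
    refine Finset.sum_congr rfl fun w' _ => ?_
    rw [pderiv_C_mul, map_mul, ← mul_assoc]
  have hdouble : ∀ p q : Fin s × Fin d,
      (∑ w : Fin s × Fin d, ∑ w' : Fin s × Fin d, if w = p ∧ w' = q then v w * v' w' else 0) =
        v p * v' q := by
    intro p q
    rw [Finset.sum_eq_single p]
    · rw [Finset.sum_eq_single q]
      · rw [if_pos ⟨rfl, rfl⟩]
      · intro w' _ hw'
        exact if_neg fun h' => hw' h'.2
      · intro h'
        exact absurd (Finset.mem_univ q) h'
    · intro w _ hw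
      exact Finset.sum_eq_zero fun w' _ => if_neg fun h' => hw h'.1
    · intro h'
      exact absurd (Finset.mem_univ p) h'
  rw [hexp, coeff_sum]
  simp_rw [coeff_sum, coeff_C_mul, hterm, mul_add, Finset.sum_add_distrib, mul_ite, mul_one, mul_zero]
  rw [hdouble, hdouble]

/-- Hence a nonvanishing "witness" `v_{(a,j₁)} v'_{(a,j₂)} + v_{(a,j₂)} v'_{(a,j₁)} ≠ 0` makes
`∂_v ∂_{v'} T' ≠ 0` (`d ≥ 3`). [cite: MediniShpilka2021, §6.2 (arXiv p0035:L10-L12), proof of Thm 45 (p0036:L38-L50)] -/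
theorem dirDeriv_dirDeriv_sum_prod_X_ne_zero (hd : 3 ≤ d) (v v' : Fin s × Fin d → K) (a : Fin s)
    {j₁ j₂ : Fin d} (hj : j₁ ≠ j₂) (hw : v (a, j₁) * v' (a, j₂) + v (a, j₂) * v' (a, j₁) ≠ 0) :
    (∑ w, C (v w) * pderiv w (∑ w', C (v' w') * pderiv w'
      (∑ a : Fin s, ∏ j : Fin d, X (a, j) : MvPolynomial (Fin s × Fin d) K))) ≠ 0 := by
  intro h0
  have := coeff_dirDeriv_dirDeriv_sum_prod_X hd v v' a hj
  rw [h0, coeff_zero] at this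
  exact hw this.symm

end SecondDerivative

/-! ### The chain rule for a linear substitution `y_c ↦ ∑_w M_{c,w} y_w` and its dual vectors -/

section LinearSubst

variable {K : Type*} [Field K] {σ τ : Type*} [Fintype σ] [Fintype τ] [DecidableEq σ] [DecidableEq τ]

/-- Chain rule: `∂_v (q ∘ M) = ((M v)·∇ q) ∘ M` for the substitution `y_c ↦ ∑_w M_{c,w} x_w`.
[cite: MediniShpilka2021, Def 3.6 (chain rule display; arXiv p0017:L49-L51)] -/
theorem dirDeriv_aeval_linear (M : σ → τ → K) (v : τ → K) (q : MvPolynomial σ K) :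
    (∑ w, C (v w) * pderiv w (aeval (fun c => ∑ w, C (M c w) * X w : σ → MvPolynomial τ K) q)) =
      aeval (fun c => ∑ w, C (M c w) * X w : σ → MvPolynomial τ K)
        (∑ c, C (∑ w, M c w * v w) * pderiv c q) := by
  have hlin : ∀ (c : σ) (w : τ),
      pderiv w (∑ w', C (M c w') * X w' : MvPolynomial τ K) = C (M c w) := by
    intro c w
    simp only [map_sum, pderiv_C_mul, pderiv_X, Pi.single_apply, mul_ite, mul_one, mul_zero,
      Finset.sum_ite_eq', Finset.mem_univ, if_true]
  simp_rw [_root_.Literature.Algebra.Polynomial.JacobianCriterion.pderiv_aeval, hlin, Finset.mul_sum]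
  rw [Finset.sum_comm, map_sum]
  refine Finset.sum_congr rfl fun c _ => ?_
  rw [map_mul, algHom_C, algebraMap_eq, map_sum, Finset.sum_mul]
  refine Finset.sum_congr rfl fun w _ => ?_
  rw [map_mul]
  ring

/-- **Lemma 3.8 for the second family**: along a dual vector `v_c` of the forms
`m_{c'} = ∑_w M_{c',w} y_w` (`M v_c = e_c`), `∂_{v_c} (q ∘ M) = (∂_c q) ∘ M`.
[cite: MediniShpilka2021, Lemma 3.8 (arXiv p0017:L61-L68)] -/
theorem dualDeriv_aeval_linear (M : σ → τ → K) (N : τ → σ → K)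
    (hMN : ∀ c c' : σ, (∑ w, M c w * N w c') = if c = c' then 1 else 0) (c : σ)
    (q : MvPolynomial σ K) :
    (∑ w, C (N w c) * pderiv w (aeval (fun c => ∑ w, C (M c w) * X w : σ → MvPolynomial τ K) q)) =
      aeval (fun c => ∑ w, C (M c w) * X w : σ → MvPolynomial τ K) (pderiv c q) := by
  rw [dirDeriv_aeval_linear]
  congr 1
  simp_rw [hMN]
  rw [Finset.sum_eq_single c]
  · rw [if_pos rfl, C_1, one_mul]
  · intro c' _ hc'
    rw [if_neg hc', C_0, zero_mul]
  · intro h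
    exact absurd (Finset.mem_univ c) h

end LinearSubst

/-! ### Transport to the orbit: derivatives of `q(ℓ_1(x))` along prescribed `ℓ_1`-values -/

section Transport

variable {K : Type*} [Field K] {n s d : ℕ}

/-- Along `u := ∑_w v_w · (column ℓ_{1,w} of A⁻¹)` — the vector with `ℓ_{1,w}(u) = v_w` — the
derivative of `q(ℓ_1(x))` is `(∂_v q)(ℓ_1(x))`. [cite: MediniShpilka2021, Lemma 3.8 (arXiv p0017:L61-L68)] -/
theorem dirDeriv_affSubst_rename_of_values (h : s * d ≤ n) {A : Matrix (Fin n) (Fin n) K}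
    (hA : IsUnit A.det) (v : Fin s × Fin d → K) (q : MvPolynomial (Fin s × Fin d) K) :
    (∑ j, C (∑ w, A⁻¹ j (Fin.castLE h (finProdFinEquiv w)) * v w) *
        pderiv j (affSubst h A 0 (rename finProdFinEquiv q))) =
      affSubst h A 0 (rename finProdFinEquiv (∑ w, C (v w) * pderiv w q)) := by
  classical
  have hexp : (∑ j, C (∑ w, A⁻¹ j (Fin.castLE h (finProdFinEquiv w)) * v w) *
      pderiv j (affSubst h A 0 (rename finProdFinEquiv q))) =
      ∑ w, C (v w) * ∑ j, C (A⁻¹ j (Fin.castLE h (finProdFinEquiv w))) *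
        pderiv j (affSubst h A 0 (rename finProdFinEquiv q)) := by
    simp_rw [map_sum, Finset.sum_mul, Finset.mul_sum]
    rw [Finset.sum_comm]
    refine Finset.sum_congr rfl fun w _ => Finset.sum_congr rfl fun j _ => ?_
    rw [map_mul]
    ring
  rw [hexp]
  simp_rw [dualDeriv_affSubst_rename h hA]
  unfold affSubst
  simp only [map_sum, map_mul, algHom_C, algebraMap_eq]

end Transport

/-! ### The witness branch: a second derivative killing `f₂` and not `f₁` (every field, `d ≥ 3`) -/

section Witness

variable {K : Type*} [Field K] {n c s d : ℕ}

/-- **Thm 45, `d ≥ 3`, the swapped dual set**: let `ℓ_{2,c} = ∑_w M_{c,w} ℓ_{1,w}` and `N` a right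
inverse of `M` (its columns are the `ℓ_2`-dual vectors in `ℓ_1`-coordinates). If for two indices
`c, c'` in different blocks, or `c = c'`, some `N_{(a,j₁),c} N_{(a,j₂),c'} + N_{(a,j₂),c} N_{(a,j₁),c'} ≠ 0`
(`j₁ ≠ j₂`), then every `6`-independent map hits `f₁ - f₂`: along the transported directions
`∂²f₂/∂u∂w = 0` ("`∂²T/∂x_{i,j}∂x_{i',j'} = 0`" for distinct gates; `T` is multilinear) while
`∂²f₁/∂u∂w ≠ 0`, and Lemma 6.2 (`k = 2`) applies to `f₁`. No hypothesis on the characteristic.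
[cite: MediniShpilka2021, §6.2 and proof of Thm 45 (arXiv p0035:L10-L12, p0036:L33-L50)] -/
theorem bind₁_sub_ne_zero_of_witness (hd : 3 ≤ d) (h₁ h₂ : s * d ≤ n)
    {A₁ A₂ : Matrix (Fin n) (Fin n) K} (hA₁ : IsUnit A₁.det)
    (M N : Fin s × Fin d → Fin s × Fin d → K)
    (hM : ∀ v k, A₂ (Fin.castLE h₂ (finProdFinEquiv v)) k =
      ∑ w, M v w * A₁ (Fin.castLE h₁ (finProdFinEquiv w)) k)
    (hMN : ∀ c c' : Fin s × Fin d, (∑ w, M c w * N w c') = if c = c' then 1 else 0)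
    (c₁ c₂ : Fin s × Fin d) (hc : c₁ = c₂ ∨ c₁.1 ≠ c₂.1) (a : Fin s) {j₁ j₂ : Fin d} (hj : j₁ ≠ j₂)
    (hw : N (a, j₁) c₁ * N (a, j₂) c₂ + N (a, j₂) c₁ * N (a, j₁) c₂ ≠ 0)
    {G : Fin n → MvPolynomial (Fin 6 × (Fin c ⊕ Unit)) K} (hG : IsIndependent 6 G) :
    bind₁ G (affSubst h₁ A₁ 0 (rename finProdFinEquiv (∑ a : Fin s, ∏ j : Fin d, X (a, j))) -
      affSubst h₂ A₂ 0 (rename finProdFinEquiv (∑ a : Fin s, ∏ j : Fin d, X (a, j)))) ≠ 0 := by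
  classical
  -- `f₂ = (T' ∘ M)(ℓ_1)`
  obtain ⟨P, hP⟩ : ∃ P : MvPolynomial (Fin s × Fin d) K,
      aeval (fun v : Fin s × Fin d => ∑ w : Fin s × Fin d, (C (M v w) * X w :
        MvPolynomial (Fin s × Fin d) K))
        (∑ a : Fin s, ∏ j : Fin d, X (a, j) : MvPolynomial (Fin s × Fin d) K) = P := ⟨_, rfl⟩
  have hf₂ : affSubst h₂ A₂ 0 (rename finProdFinEquiv (∑ a : Fin s, ∏ j : Fin d, X (a, j))) =
      affSubst h₁ A₁ 0 (rename finProdFinEquiv P) := by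
    rw [← hP]
    exact affSubst_rename_eq_of_rows_eq h₁ h₂ A₁ A₂ M hM _
  rw [hf₂]
  -- the two transported directions
  refine bind₁_ne_zero_of_forall_dirDeriv_dirDeriv hG _
    (fun j => ∑ w, A₁⁻¹ j (Fin.castLE h₁ (finProdFinEquiv w)) * N w c₁)
    (fun j => ∑ w, A₁⁻¹ j (Fin.castLE h₁ (finProdFinEquiv w)) * N w c₂) fun G'' hG'' => ?_
  have hDD : ∀ q : MvPolynomial (Fin s × Fin d) K,
      (∑ j, C (∑ w, A₁⁻¹ j (Fin.castLE h₁ (finProdFinEquiv w)) * N w c₁) * pderiv j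
        (∑ j', C (∑ w, A₁⁻¹ j' (Fin.castLE h₁ (finProdFinEquiv w)) * N w c₂) * pderiv j'
          (affSubst h₁ A₁ 0 (rename finProdFinEquiv q)))) =
        affSubst h₁ A₁ 0 (rename finProdFinEquiv
          (∑ w, C (N w c₁) * pderiv w (∑ w', C (N w' c₂) * pderiv w' q))) := by
    intro q
    rw [dirDeriv_affSubst_rename_of_values h₁ hA₁, dirDeriv_affSubst_rename_of_values h₁ hA₁]
  -- on `f₂` the second derivative vanishes
  have hP0 : (∑ w, C (N w c₁) * pderiv w (∑ w', C (N w' c₂) * pderiv w' P)) = 0 := by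
    rw [← hP, dualDeriv_aeval_linear M N hMN, dualDeriv_aeval_linear M N hMN,
      pderiv_pderiv_sum_prod_X c₁ c₂ hc, map_zero]
  -- on `f₁` it does not
  have hT0 : (∑ w, C (N w c₁) * pderiv w (∑ w', C (N w' c₂) * pderiv w'
      (∑ a : Fin s, ∏ j : Fin d, X (a, j) : MvPolynomial (Fin s × Fin d) K))) ≠ 0 :=
    dirDeriv_dirDeriv_sum_prod_X_ne_zero hd _ _ a hj hw
  have hlin : ∀ (u w : Fin n → K) (p q : MvPolynomial (Fin n) K),
      (∑ j, C (u j) * pderiv j (∑ j', C (w j') * pderiv j' (p - q))) =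
        (∑ j, C (u j) * pderiv j (∑ j', C (w j') * pderiv j' p)) -
          ∑ j, C (u j) * pderiv j (∑ j', C (w j') * pderiv j' q) := by
    intro u w p q
    simp only [map_sub, mul_sub, Finset.sum_sub_distrib]
  rw [hlin, hDD, hDD, hP0, map_zero]
  have h0 : affSubst h₁ A₁ 0 (0 : MvPolynomial (Fin (s * d)) K) = 0 := by
    unfold affSubst
    exact map_zero _
  rw [h0, sub_zero, ← dirDeriv_affSubst_rename_of_values h₁ hA₁,
    ← dirDeriv_affSubst_rename_of_values h₁ hA₁]
  refine bind₁_dirDeriv_dirDeriv_ne_zero_of_mem_affOrbit_sdm ⟨h₁, A₁, 0, hA₁, by rw [sdm_eq_rename]⟩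
    _ _ ?_ hG'' le_rfl
  rw [dirDeriv_affSubst_rename_of_values h₁ hA₁, dirDeriv_affSubst_rename_of_values h₁ hA₁]
  intro hz
  have hz' := eq_zero_of_affSubst_eq_zero h₁ hA₁ 0 hz
  rw [map_eq_zero_iff _ (rename_injective _ finProdFinEquiv.injective)] at hz'
  exact hT0 hz'

end Witness

/-! ### The decoupling lemma: no witness ⇒ the two families agree block by block -/

section Decoupling

variable {K : Type*} [Field K] {n s d : ℕ}

/-- Rows of one `ℓ_1`-block of the coefficient matrix are linearly independent: if
`∑_j κ_j N_{(a,j),c} = 0` for all `c` then `κ = 0` (apply to `ℓ_{1,(a,j)} = ∑_c N_{(a,j),c} ℓ_{2,c}` and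
use the independence of the `ℓ_1`). [folklore] -/
private theorem rowBlock_eq_zero (L₁ L₂ : Fin s × Fin d → (Fin n → K)) (h₁ : LinearIndependent K L₁)
    (N : Fin s × Fin d → Fin s × Fin d → K) (hN : ∀ w k, L₁ w k = ∑ c, N w c * L₂ c k)
    (a : Fin s) (κ : Fin d → K) (hκ : ∀ c, (∑ j, κ j * N (a, j) c) = 0) : κ = 0 := by
  classical
  have hsum : (∑ w : Fin s × Fin d, (if w.1 = a then κ w.2 else 0) • L₁ w) = 0 := by
    have hre : (∑ w : Fin s × Fin d, (if w.1 = a then κ w.2 else 0) • L₁ w) =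
        ∑ j : Fin d, κ j • L₁ (a, j) := by
      rw [Fintype.sum_prod_type, Finset.sum_eq_single a]
      · exact Finset.sum_congr rfl fun j _ => by rw [if_pos rfl]
      · intro a' _ ha'
        exact Finset.sum_eq_zero fun j _ => by rw [if_neg ha', zero_smul]
      · intro h'
        exact absurd (Finset.mem_univ a) h'
    rw [hre]
    funext k
    rw [Finset.sum_apply, Pi.zero_apply]
    simp only [Pi.smul_apply, smul_eq_mul, hN, Finset.mul_sum]
    rw [Finset.sum_comm]
    refine Finset.sum_eq_zero fun c _ => ?_
    have := hκ c
    calc (∑ j, κ j * (N (a, j) c * L₂ c k)) = (∑ j, κ j * N (a, j) c) * L₂ c k := by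
          rw [Finset.sum_mul]
          exact Finset.sum_congr rfl fun j _ => by ring
      _ = 0 := by rw [this, zero_mul]
  have hall := Fintype.linearIndependent_iff.1 h₁ _ hsum
  funext j
  have := hall (a, j)
  simpa using this

/-- Two columns with a nonvanishing `2 × 2` minor inside the `a`-block (`d ≥ 2`). [folklore] -/
private theorem exists_minor_ne_zero (hd : 2 ≤ d) (L₁ L₂ : Fin s × Fin d → (Fin n → K))
    (h₁ : LinearIndependent K L₁) (N : Fin s × Fin d → Fin s × Fin d → K)
    (hN : ∀ w k, L₁ w k = ∑ c, N w c * L₂ c k) (a : Fin s) :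
    ∃ (c₁ c₂ : Fin s × Fin d) (j₁ j₂ : Fin d), j₁ ≠ j₂ ∧
      N (a, j₁) c₁ * N (a, j₂) c₂ - N (a, j₂) c₁ * N (a, j₁) c₂ ≠ 0 := by
  classical
  by_contra hno
  push Not at hno
  -- some entry of the block is nonzero
  have hd0 : 0 < d := by omega
  obtain ⟨j₀, c₀, hj₀⟩ : ∃ (j₀ : Fin d) (c₀ : Fin s × Fin d), N (a, j₀) c₀ ≠ 0 := by
    by_contra hz
    push Not at hz
    have := rowBlock_eq_zero L₁ L₂ h₁ N hN a (fun _ => 1) fun c => by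
      simp [hz]
    exact one_ne_zero (congr_fun this ⟨0, hd0⟩)
  obtain ⟨j₁, hj₁⟩ : ∃ j₁ : Fin d, j₁ ≠ j₀ :=
    ⟨⟨if j₀.val = 0 then 1 else 0, by split_ifs <;> omega⟩, fun h => by
      have := congr_arg Fin.val h
      simp only at this
      split_ifs at this with h0 <;> omega⟩
  -- the combination `N_{(a,j₁),c₀} · row j₀ - N_{(a,j₀),c₀} · row j₁` vanishes (all minors with `c₀` do)
  have hκ := rowBlock_eq_zero L₁ L₂ h₁ N hN a
    (Pi.single j₀ (N (a, j₁) c₀) - Pi.single j₁ (N (a, j₀) c₀)) fun c => by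
      simp only [Pi.sub_apply, sub_mul, Finset.sum_sub_distrib, Pi.single_apply, ite_mul, zero_mul,
        Finset.sum_ite_eq', Finset.mem_univ, if_true]
      have := hno c₀ c j₁ j₀ hj₁
      linear_combination this
  have := congr_fun hκ j₁
  simp only [Pi.sub_apply, Pi.single_apply, if_neg hj₁, Pi.zero_apply, zero_sub,
    neg_eq_zero] at this
  exact hj₀ this

/-- Key step: a nonvanishing minor between two columns of DIFFERENT blocks is a witness.
Contrapositive form. [cite: MediniShpilka2021, proof of Thm 45 (arXiv p0036:L33-L50), repaired] -/
private theorem minor_eq_zero_of_no_witness (N : Fin s × Fin d → Fin s × Fin d → K)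
    (hS : ∀ (c : Fin s × Fin d) (a : Fin s) (j₁ j₂ : Fin d), j₁ ≠ j₂ →
      (2 : K) * N (a, j₁) c * N (a, j₂) c = 0)
    (hP : ∀ c c' : Fin s × Fin d, c.1 ≠ c'.1 → ∀ (a : Fin s) (j₁ j₂ : Fin d), j₁ ≠ j₂ →
      N (a, j₁) c * N (a, j₂) c' + N (a, j₂) c * N (a, j₁) c' = 0)
    {c₁ c₂ : Fin s × Fin d} (hc : c₁.1 ≠ c₂.1) (a : Fin s) {j₁ j₂ : Fin d} (hj : j₁ ≠ j₂) :
    N (a, j₁) c₁ * N (a, j₂) c₂ - N (a, j₂) c₁ * N (a, j₁) c₂ = 0 := by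
  have e := hP c₁ c₂ hc a j₁ j₂ hj
  have s1 := hS c₁ a j₁ j₂ hj
  by_cases hx₂ : N (a, j₂) c₁ = 0
  · rw [hx₂, zero_mul, add_zero] at e
    rw [e, hx₂, zero_mul, sub_zero]
  · rcases mul_eq_zero.1 s1 with h2 | h2
    · rcases mul_eq_zero.1 h2 with h22 | hx₁
      · -- characteristic two: the minor IS the witness expression
        have : N (a, j₁) c₁ * N (a, j₂) c₂ - N (a, j₂) c₁ * N (a, j₁) c₂ =
            (N (a, j₁) c₁ * N (a, j₂) c₂ + N (a, j₂) c₁ * N (a, j₁) c₂) -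
              2 * (N (a, j₂) c₁ * N (a, j₁) c₂) := by ring
        rw [this, e, h22, zero_mul, sub_zero]
      · rw [hx₁, zero_mul, zero_add] at e
        rcases mul_eq_zero.1 e with h' | hy₁
        · exact absurd h' hx₂
        · rw [hx₁, hy₁, zero_mul, mul_zero, sub_zero]
    · exact absurd h2 hx₂

/-- Proportional columns have vanishing mutual minors. [folklore] -/
private theorem minor_eq_zero_of_prop {x y z : Fin d → K} {j₀ : Fin d} (hz : z j₀ ≠ 0)
    (hx : ∀ j, x j * z j₀ = x j₀ * z j) (hy : ∀ j, y j * z j₀ = y j₀ * z j) (j₁ j₂ : Fin d) :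
    x j₁ * y j₂ - x j₂ * y j₁ = 0 := by
  have ex : ∀ j, x j = x j₀ * z j / z j₀ := fun j => by rw [eq_div_iff hz, hx]
  have ey : ∀ j, y j = y j₀ * z j / z j₀ := fun j => by rw [eq_div_iff hz, hy]
  rw [ex j₁, ex j₂, ey j₁, ey j₂]
  field_simp
  ring

/-- **The decoupling lemma.** Two linearly independent families `ℓ_1, ℓ_2` of `s·d` forms with
`ℓ_{1,w} = ∑_c N_{w,c} ℓ_{2,c}` and NO witness — no column `c` and no pair of columns in different
blocks exhibiting a nonzero `2 N_{(a,j₁),c} N_{(a,j₂),c}`, resp. `N_{(a,j₁),c}N_{(a,j₂),c'} +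
N_{(a,j₂),c}N_{(a,j₁),c'}` — agree block by block: `span{ℓ_{1,a,·}} = span{ℓ_{2,β(a),·}}` for a
bijection `β` (`d ≥ 2`). This is the structural content behind the printed "from this point on
… span = span … we can represent `f₂` as a polynomial in `{ℓ_{1,i,j}}`", pushed one level down to the
product gates. [cite: MediniShpilka2021, proof of Thm 45 (arXiv p0036:L22-L28), repaired (seat note x6g3-MS21-Thm45-allchar-REPAIR.md §3)] -/
theorem exists_bijective_span_eq_of_no_witness (hd : 2 ≤ d)
    (L₁ L₂ : Fin s × Fin d → (Fin n → K)) (h₁ : LinearIndependent K L₁)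
    (h₂ : LinearIndependent K L₂) (N : Fin s × Fin d → Fin s × Fin d → K)
    (hN : ∀ w k, L₁ w k = ∑ c, N w c * L₂ c k)
    (hS : ∀ (c : Fin s × Fin d) (a : Fin s) (j₁ j₂ : Fin d), j₁ ≠ j₂ →
      (2 : K) * N (a, j₁) c * N (a, j₂) c = 0)
    (hP : ∀ c c' : Fin s × Fin d, c.1 ≠ c'.1 → ∀ (a : Fin s) (j₁ j₂ : Fin d), j₁ ≠ j₂ →
      N (a, j₁) c * N (a, j₂) c' + N (a, j₂) c * N (a, j₁) c' = 0) :
    ∃ β : Fin s → Fin s, Function.Bijective β ∧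
      (∀ (a : Fin s) (c : Fin s × Fin d), c.1 ≠ β a → ∀ j, N (a, j) c = 0) ∧
      ∀ a, Submodule.span K (Set.range fun j : Fin d => L₁ (a, j)) =
        Submodule.span K (Set.range fun j : Fin d => L₂ (β a, j)) := by
  classical
  have hd0 : 0 < d := by omega
  -- block by block: all columns with a nonzero `a`-part lie in one block
  have hblock : ∀ a : Fin s, ∃ b : Fin s, ∀ c : Fin s × Fin d, c.1 ≠ b → ∀ j, N (a, j) c = 0 := by
    intro a
    obtain ⟨c₁, c₂, j₁, j₂, hj, hmin⟩ := exists_minor_ne_zero hd L₁ L₂ h₁ N hN a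
    have hsame : c₁.1 = c₂.1 := by
      by_contra hne
      exact hmin (minor_eq_zero_of_no_witness N hS hP hne a hj)
    refine ⟨c₁.1, fun c hc j => ?_⟩
    by_contra hz
    -- `c` has a nonzero minor with `c₁` or with `c₂`
    have key : ∃ (c' : Fin s × Fin d) (i₁ i₂ : Fin d), c'.1 = c₁.1 ∧ i₁ ≠ i₂ ∧
        N (a, i₁) c * N (a, i₂) c' - N (a, i₂) c * N (a, i₁) c' ≠ 0 := by
      by_contra hno
      push Not at hno
      have hx : ∀ i, N (a, i) c₁ * N (a, j) c = N (a, j) c₁ * N (a, i) c := by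
        intro i
        by_cases hij : i = j
        · rw [hij]
        · have := hno c₁ j i rfl (Ne.symm hij)
          linear_combination this
      have hy : ∀ i, N (a, i) c₂ * N (a, j) c = N (a, j) c₂ * N (a, i) c := by
        intro i
        by_cases hij : i = j
        · rw [hij]
        · have := hno c₂ j i hsame.symm (Ne.symm hij)
          linear_combination this
      exact hmin (minor_eq_zero_of_prop (x := fun i => N (a, i) c₁) (y := fun i => N (a, i) c₂)
        (z := fun i => N (a, i) c) hz hx hy j₁ j₂)
    obtain ⟨c', i₁, i₂, hc', hi, hmin'⟩ := key
    exact hmin' (minor_eq_zero_of_no_witness N hS hP (by rw [hc']; exact hc) a hi)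
  choose β hβ using hblock
  -- spans
  have hspan : ∀ a, Submodule.span K (Set.range fun j : Fin d => L₁ (a, j)) =
      Submodule.span K (Set.range fun j : Fin d => L₂ (β a, j)) := by
    intro a
    apply Submodule.eq_of_le_of_finrank_eq
    · rw [Submodule.span_le]
      rintro _ ⟨j, rfl⟩
      have hrep : L₁ (a, j) = ∑ j' : Fin d, N (a, j) (β a, j') • L₂ (β a, j') := by
        funext k
        rw [hN, Finset.sum_apply]
        simp only [Pi.smul_apply, smul_eq_mul]
        rw [← Finset.sum_filter_add_sum_filter_not Finset.univ (fun c : Fin s × Fin d => c.1 = β a)]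
        have hzero : (∑ c ∈ Finset.univ.filter (fun c : Fin s × Fin d => ¬c.1 = β a),
            N (a, j) c * L₂ c k) = 0 :=
          Finset.sum_eq_zero fun c hc => by
            rw [Finset.mem_filter] at hc
            rw [hβ a c hc.2 j, zero_mul]
        rw [hzero, add_zero, show (Finset.univ.filter fun c : Fin s × Fin d => c.1 = β a) =
          (Finset.univ : Finset (Fin d)).map ⟨fun j' => (β a, j'), fun _ _ h => (Prod.mk.inj h).2⟩
          from ?_, Finset.sum_map]
        · rfl
        · ext c
          simp only [Finset.mem_filter, Finset.mem_univ, true_and, Finset.mem_map,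
            Function.Embedding.coeFn_mk]
          exact ⟨fun h => ⟨c.2, by rw [← h]⟩, fun ⟨j', h⟩ => by rw [← h]⟩
      change L₁ (a, j) ∈ _
      rw [hrep]
      exact Submodule.sum_mem _ fun j' _ =>
        Submodule.smul_mem _ _ (Submodule.subset_span ⟨j', rfl⟩)
    · have e₁ : LinearIndependent K (fun j : Fin d => L₁ (a, j)) :=
        h₁.comp (fun j : Fin d => (a, j)) fun _ _ h => (Prod.mk.inj h).2
      have e₂ : LinearIndependent K (fun j : Fin d => L₂ (β a, j)) :=
        h₂.comp (fun j : Fin d => (β a, j)) fun _ _ h => (Prod.mk.inj h).2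
      rw [finrank_span_eq_card e₁, finrank_span_eq_card e₂]
  -- `β` is injective (hence bijective): distinct `ℓ_1`-blocks have different spans
  have hinj : Function.Injective β := by
    intro a a' haa
    by_contra hne
    have hmem : L₁ (a, ⟨0, hd0⟩) ∈ Submodule.span K (Set.range fun j : Fin d => L₁ (a', j)) := by
      rw [hspan a', ← haa, ← hspan a]
      exact Submodule.subset_span ⟨⟨0, hd0⟩, rfl⟩
    have hnot := h₁.notMem_span_image (s := {w : Fin s × Fin d | w.1 = a'})
      (x := (a, ⟨0, hd0⟩)) (by simpa using hne)
    apply hnot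
    have hset : (Set.range fun j : Fin d => L₁ (a', j)) ⊆ L₁ '' {w : Fin s × Fin d | w.1 = a'} := by
      rintro _ ⟨j, rfl⟩
      exact ⟨(a', j), rfl, rfl⟩
    exact Submodule.span_mono hset hmem
  exact ⟨β, ⟨hinj, Finite.surjective_of_injective hinj⟩, hβ, hspan⟩

end Decoupling

end MS2021

end Literature.Computability.AlgebraicComplexity

end
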